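import Summits.NavierStokesRegularity.OSWSelfSimilar.SheetREvenAssemblyOperators
import Summits.NavierStokesRegularity.OSWSelfSimilar.CertificateViscousSheetRSpectrumEven
import HarnessLib

/-!
# SHEET-ℝ frame, EVEN ZERO-MASS class `E⁺₀`: the sheet's CONCRETE even operators, part 2 — the second variation
# `B⁺_u = DG⁺(Ω̄ + u) − DG⁺(Ω̄)` as a BOUNDED OPERATOR `secondVariationE hL a u : EspE L hL →L[ℝ] W L`, with `‖B⁺_u‖ ≤ (L_lip/2)‖u‖_E ≤ Δ⁺/2`

HONEST FRAMING (cell ns-blowup GROUP B / zone Z3, case Z3-SR-SPEC EVEN half, HYPOTHESIS-LEDGER row (P8⁺); DESIGN-Z3-SR-SPEC-EVEN (D2)/(D3); 1-D MODEL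
certificate frame (viscous gCLM/OSW sheet on the line); not Euler/NS; «violates: none — MODEL»).  Nothing here asserts that a profile exists; no
number of record moves.  Companion of `SheetREvenAssemblyOperators` (part 1: `PopE`; split by the ≤ 400-line rule) and the even twin of cert-5 g6's
`SheetRLinearisationPerturbation` §3 (`B_u = Qop u + (Qop)ᵀ u`, `‖B_u‖ ≤ (L_lip/2)‖u‖_E`):

* **`secondVariationE hL a u`** `: EspE L hL →L[ℝ] W L` for an odd `u ∈ Esp` (profile `prim (der u)`, pinned velocity `𝒰u = ∫₀Hu`) acting on the
  even zero-mass `δ = profile p` (covariant velocity `𝒰⁺δ = ∫_{(−∞,ξ]} Hδ`): `δ ↦ (a𝒰u·δ′ − Hu·δ) + (a𝒰⁺δ·u₁ − Hδ·u) = (DG⁺(Ω̄ + u) − DG⁺(Ω̄))δ`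
  (the profile map `G(Ω) = Ω + ½ξΩ′ + a𝒰Ω·Ω′ − HΩ·Ω − Ω″` is quadratic; function avatar `secondVariationEFun`);
* `‖B⁺_u δ‖_w ≤ 2M_w‖u‖_E‖p‖` (`memLp_secondVariationEFun`: the four pieces by the sup bounds of the two velocities and of the two profiles, the two
  weighted isometries `‖Hu‖_w = ‖u‖_w` (odd) / `‖Hδ‖_w = ‖δ‖_w` (zero mass, cert-1), and `‖·‖_w ≤ 2‖·‖_E`; `M_w = 2|a|(π/(4L))^{1/2} + 2√2/L`) — the
  operator-norm form of cert-1 g8's function-level `abs_pairing_linearisation_diff_even_le`;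
* at `(L, a) = (8, 1/5)`: `‖B⁺_u‖ ≤ (L_lip/2)‖u‖_E` (`four_Mw_le_Llip`) and, on the certified ball `‖u‖_E ≤ rE♯₂`, **`‖B⁺_u‖ ≤ Δ⁺/2`**
  (`Δ⁺ = DeltaE = LlipE·rE♯₂`, `L_lip ≤ LlipE`) — the hypothesis `‖K' − K‖ ≤ Δ⁺/2` of cert-5 g9's
  `SheetREvenLinearisationPerturbation.evansEven_pert_of_record` / `gardingDataKE_of_record` for `K' := K + B⁺_u`.
One definition with body (`secondVariationE`; function avatar `secondVariationEFun`); no named fact, no `Prop` hypothesis.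
WHAT THIS IS NOT: not NS; not the spectral certificate; no interval arithmetic.
-/

noncomputable section

namespace Summit.NavierStokesRegularity.OSWSelfSimilar
namespace SheetREvenSecondVariation

open _root_.MeasureTheory _root_.Set _root_.Filter _root_.Real Literature.Analysis.Fourier SheetRWeakProfilePV SheetRWeakToStrong
  SheetREnergyClass SheetRWeightedMeasure SheetRWeightedEmbeddings SheetREnergySpace SheetRSolutionOperator SheetRWeakPairingExpansion
  SheetRAssemblyOperators SheetRCertificateAssembly SheetREvenTests SheetREvenEnergySpace SheetREvenForms SheetREvenEnergyClass
  SheetREvenAssemblyOperators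
open scoped Topology ENNReal

/-! ### §1 The second variation `B⁺_u = DG⁺(Ω̄ + u) − DG⁺(Ω̄)` as a bounded operator `EspE L hL →L W L` -/

section SecondVariation

variable {L : ℝ} (hL : 0 < L) (a : ℝ)

/-- The function `B⁺_u δ = (a·𝒰u·δ′ − Hu·δ) + (a·𝒰⁺δ·u₁ − Hδ·u)` of the ODD profile `u = prim (der q)` (`𝒰u = ∫₀Hu` pinned) and the EVEN
zero-mass profile `δ = profile p` (`𝒰⁺δ = ∫_{(−∞,ξ]} Hδ` covariant): the symmetrised quadratic part of the profile map, i.e.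
`(DG⁺(Ω̄ + u) − DG⁺(Ω̄))δ`. [folklore] -/
def secondVariationEFun (L a : ℝ) {hL : 0 < L} (q : Esp L hL) (p : EspE L hL) (ξ : ℝ) : ℝ :=
  (a * (∫ s in (0 : ℝ)..ξ, hilbertTransform (prim (der q)) s) * derE p ξ - hilbertTransform (prim (der q)) ξ * profile p ξ)
    + (a * (∫ s in Iic ξ, hilbertTransform (profile p) s) * der q ξ - hilbertTransform (profile p) ξ * prim (der q) ξ)

include hL in
/-- `B⁺_u δ ∈ L²(μ_w)` with `(∫ w (B⁺_u δ)²)^{1/2} ≤ 2M_w‖q‖‖p‖` (`M_w = 2|a|(π/(4L))^{1/2} + 2√2/L`): the four pieces are bounded by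
`|a|(π/(4L))^{1/2}‖u‖_w‖δ′‖_w`, `(√2/L)‖p‖‖Hu‖_w`, `|a|(π/(4L))^{1/2}‖δ‖_w‖u₁‖_w`, `(√2/L)‖q‖‖Hδ‖_w` (sup bounds of the velocities and of the
profiles, the two weighted isometries, `‖·‖_w ≤ 2‖·‖_E`). [folklore] -/
theorem memLp_secondVariationEFun (q : Esp L hL) (p : EspE L hL) :
    MemLp (secondVariationEFun L a q p) 2 (μw L) ∧
      Real.sqrt (∫ y, (L ^ 2 + y ^ 2) * secondVariationEFun L a q p y ^ 2) ≤ 2 * Mw L a * ‖q‖ * ‖p‖ := by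
  -- the odd profile `u`
  obtain ⟨hu, hodd, hum, hu0, hu1, -⟩ := profile_of_mem hL q
  obtain ⟨hu₁2, hui, hu2⟩ := basic_of_mem hL q
  obtain ⟨hHum, -, hwHu, hisou⟩ := weightedSq_hilbertTransform_of_primitive hL hu hodd hum hu0 hu1
  have huc : Continuous (prim (der q)) := continuous_prim hL _
  have hUuc : Continuous fun ξ => ∫ s in (0 : ℝ)..ξ, hilbertTransform (prim (der q)) s :=
    continuous_velocity_of_primitive hu hu₁2 hui hu2
  have hUu : ∀ ξ, |∫ s in (0 : ℝ)..ξ, hilbertTransform (prim (der q)) s| ≤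
      Real.sqrt (π / (4 * L)) * Real.sqrt (∫ y, (L ^ 2 + y ^ 2) * prim (der q) y ^ 2) := fun ξ =>
    abs_velocity_le_of_primitive hL hu hodd hum hu0 hu1 ξ
  have hsupu : ∀ ξ, |prim (der q) ξ| ≤ Real.sqrt 2 / L * ‖q‖ := fun ξ => by
    rw [← sqrt_energy_eq_norm hL q]; exact abs_le_sqrt_two_div_mul_energy_of_primitive hL hu hum hu0 hu1 ξ
  -- the even profile `δ`
  obtain ⟨hd, hev, hdm, hd0, hd1, hz, -⟩ := profileE_of_mem hL p
  obtain ⟨hdc, -, -, -⟩ := basicE_of_mem hL p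
  obtain ⟨hHdm, -, hwHd, hisod⟩ := hilbertE_of_mem hL p
  obtain ⟨hUdc, hUd⟩ := covariantVelocityE_of_mem hL p
  have hsupd : ∀ ξ, |profile p ξ| ≤ Real.sqrt 2 / L * ‖p‖ := fun ξ => by
    rw [← sqrt_energyE_eq_norm hL p]; exact abs_le_sqrt_two_div_mul_energy_of_primitive hL hd hdm hd0 hd1 ξ
  -- weighted norms
  set sU : ℝ := Real.sqrt (∫ y, (L ^ 2 + y ^ 2) * prim (der q) y ^ 2) with hsU
  set sU1 : ℝ := Real.sqrt (∫ y, (L ^ 2 + y ^ 2) * der q y ^ 2) with hsU1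
  set sD : ℝ := Real.sqrt (∫ y, (L ^ 2 + y ^ 2) * profile p y ^ 2) with hsD
  set sD1 : ℝ := Real.sqrt (∫ y, (L ^ 2 + y ^ 2) * derE p y ^ 2) with hsD1
  set P : ℝ := Real.sqrt (π / (4 * L)) with hP
  have hP0 : 0 ≤ P := Real.sqrt_nonneg _
  have hsU0 : 0 ≤ sU := Real.sqrt_nonneg _
  have hsD0 : 0 ≤ sD := Real.sqrt_nonneg _
  obtain ⟨hsUle, hsU1le⟩ := sqrt_weightedSq_profile_le hL q
  obtain ⟨hsDle, hsD1le⟩ := sqrt_weights_le hL p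
  have hL2 : 0 ≤ Real.sqrt 2 / L := by positivity
  -- piece 1: a·𝒰u·δ′
  set f₁ : ℝ → ℝ := fun ξ => a * (∫ s in (0 : ℝ)..ξ, hilbertTransform (prim (der q)) s) * derE p ξ with hf₁
  have hf₁m : AEStronglyMeasurable f₁ volume := ((continuous_const.mul hUuc).aestronglyMeasurable).mul hdm
  obtain ⟨hf₁i, hf₁b⟩ := weightedSq_le_of_sq_le (L := L) (C := |a| * (P * sU)) hf₁m hd1 (by positivity) fun ξ => by
    have h3 : (a * ∫ s in (0 : ℝ)..ξ, hilbertTransform (prim (der q)) s) ^ 2 ≤ (|a| * (P * sU)) ^ 2 := by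
      rw [← sq_abs (a * _), abs_mul]
      exact pow_le_pow_left₀ (by positivity) (mul_le_mul_of_nonneg_left (hUu ξ) (abs_nonneg a)) 2
    calc f₁ ξ ^ 2 = (a * ∫ s in (0 : ℝ)..ξ, hilbertTransform (prim (der q)) s) ^ 2 * derE p ξ ^ 2 := by rw [hf₁]; ring
      _ ≤ (|a| * (P * sU)) ^ 2 * derE p ξ ^ 2 := mul_le_mul_of_nonneg_right h3 (sq_nonneg _)
  -- piece 2: Hu·δ
  set f₂ : ℝ → ℝ := fun ξ => hilbertTransform (prim (der q)) ξ * profile p ξ with hf₂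
  have hf₂m : AEStronglyMeasurable f₂ volume := hHum.mul hdc.aestronglyMeasurable
  obtain ⟨hf₂i, hf₂b⟩ := weightedSq_le_of_sq_le (L := L) (C := Real.sqrt 2 / L * ‖p‖) hf₂m hwHu (by positivity) fun ξ => by
    have h2 : profile p ξ ^ 2 ≤ (Real.sqrt 2 / L * ‖p‖) ^ 2 := by
      rw [← sq_abs (profile p ξ)]; exact pow_le_pow_left₀ (abs_nonneg _) (hsupd ξ) 2
    calc f₂ ξ ^ 2 = profile p ξ ^ 2 * hilbertTransform (prim (der q)) ξ ^ 2 := by rw [hf₂]; ring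
      _ ≤ (Real.sqrt 2 / L * ‖p‖) ^ 2 * hilbertTransform (prim (der q)) ξ ^ 2 := mul_le_mul_of_nonneg_right h2 (sq_nonneg _)
  -- piece 3: a·𝒰⁺δ·u₁
  set f₃ : ℝ → ℝ := fun ξ => a * (∫ s in Iic ξ, hilbertTransform (profile p) s) * der q ξ with hf₃
  have hf₃m : AEStronglyMeasurable f₃ volume := ((continuous_const.mul hUdc).aestronglyMeasurable).mul hum
  obtain ⟨hf₃i, hf₃b⟩ := weightedSq_le_of_sq_le (L := L) (C := |a| * (P * sD)) hf₃m hu1 (by positivity) fun ξ => by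
    have h3 : (a * ∫ s in Iic ξ, hilbertTransform (profile p) s) ^ 2 ≤ (|a| * (P * sD)) ^ 2 := by
      rw [← sq_abs (a * _), abs_mul]
      exact pow_le_pow_left₀ (by positivity) (mul_le_mul_of_nonneg_left (hUd ξ) (abs_nonneg a)) 2
    calc f₃ ξ ^ 2 = (a * ∫ s in Iic ξ, hilbertTransform (profile p) s) ^ 2 * der q ξ ^ 2 := by rw [hf₃]; ring
      _ ≤ (|a| * (P * sD)) ^ 2 * der q ξ ^ 2 := mul_le_mul_of_nonneg_right h3 (sq_nonneg _)
  -- piece 4: Hδ·u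
  set f₄ : ℝ → ℝ := fun ξ => hilbertTransform (profile p) ξ * prim (der q) ξ with hf₄
  have hf₄m : AEStronglyMeasurable f₄ volume := hHdm.mul huc.aestronglyMeasurable
  obtain ⟨hf₄i, hf₄b⟩ := weightedSq_le_of_sq_le (L := L) (C := Real.sqrt 2 / L * ‖q‖) hf₄m hwHd (by positivity) fun ξ => by
    have h2 : prim (der q) ξ ^ 2 ≤ (Real.sqrt 2 / L * ‖q‖) ^ 2 := by
      rw [← sq_abs (prim (der q) ξ)]; exact pow_le_pow_left₀ (abs_nonneg _) (hsupu ξ) 2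
    calc f₄ ξ ^ 2 = prim (der q) ξ ^ 2 * hilbertTransform (profile p) ξ ^ 2 := by rw [hf₄]; ring
      _ ≤ (Real.sqrt 2 / L * ‖q‖) ^ 2 * hilbertTransform (profile p) ξ ^ 2 := mul_le_mul_of_nonneg_right h2 (sq_nonneg _)
  -- assemble
  have e : secondVariationEFun L a q p = fun ξ => (f₁ ξ - f₂ ξ) + (f₃ ξ - f₄ ξ) := by
    funext ξ; simp only [secondVariationEFun, hf₁, hf₂, hf₃, hf₄]
  have hm₁ := memLp_W hf₁m hf₁i; have hm₂ := memLp_W hf₂m hf₂i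
  have hm₃ := memLp_W hf₃m hf₃i; have hm₄ := memLp_W hf₄m hf₄i
  have hmem : MemLp (secondVariationEFun L a q p) 2 (μw L) := by rw [e]; exact (hm₁.sub hm₂).add (hm₃.sub hm₄)
  refine ⟨hmem, ?_⟩
  have hn := (norm_toLp_W hL hmem).2
  have hsum : (hmem.toLp (secondVariationEFun L a q p) : W L) = (hm₁.toLp f₁ - hm₂.toLp f₂) + (hm₃.toLp f₃ - hm₄.toLp f₄) := by
    rw [← MemLp.toLp_sub, ← MemLp.toLp_sub, ← MemLp.toLp_add]
    exact MemLp.toLp_congr _ _ (Eventually.of_forall fun ξ => by rw [e]; rfl)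
  rw [← hn, hsum]
  have hn₁ := (norm_toLp_W hL hm₁).2; have hn₂ := (norm_toLp_W hL hm₂).2
  have hn₃ := (norm_toLp_W hL hm₃).2; have hn₄ := (norm_toLp_W hL hm₄).2
  have hHu_eq : Real.sqrt (∫ y, (L ^ 2 + y ^ 2) * hilbertTransform (prim (der q)) y ^ 2) = sU := by rw [hsU, hisou]
  have hHd_eq : Real.sqrt (∫ y, (L ^ 2 + y ^ 2) * hilbertTransform (profile p) y ^ 2) = sD := by rw [hsD, hisod]
  calc ‖((hm₁.toLp f₁ - hm₂.toLp f₂) + (hm₃.toLp f₃ - hm₄.toLp f₄) : W L)‖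
      ≤ (‖(hm₁.toLp f₁ : W L)‖ + ‖(hm₂.toLp f₂ : W L)‖) + (‖(hm₃.toLp f₃ : W L)‖ + ‖(hm₄.toLp f₄ : W L)‖) :=
        (norm_add_le _ _).trans (add_le_add (norm_sub_le _ _) (norm_sub_le _ _))
    _ ≤ (|a| * (P * sU) * sD1 + Real.sqrt 2 / L * ‖p‖ * sU) + (|a| * (P * sD) * sU1 + Real.sqrt 2 / L * ‖q‖ * sD) := by
        rw [hn₁, hn₂, hn₃, hn₄]
        rw [hHu_eq] at hf₂b; rw [hHd_eq] at hf₄b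
        exact add_le_add (add_le_add hf₁b hf₂b) (add_le_add hf₃b hf₄b)
    _ ≤ (|a| * (P * (2 * ‖q‖)) * ‖p‖ + Real.sqrt 2 / L * ‖p‖ * (2 * ‖q‖))
          + (|a| * (P * (2 * ‖p‖)) * ‖q‖ + Real.sqrt 2 / L * ‖q‖ * (2 * ‖p‖)) := by
        gcongr
    _ = 2 * Mw L a * ‖q‖ * ‖p‖ := by rw [Mw]; ring

include hL in
/-- `B⁺_u` is additive in the even slot, almost everywhere (`derE (p + p') = derE p + derE p'` a.e.; the rest pointwise). [folklore] -/
theorem secondVariationEFun_add_right (q : Esp L hL) (p p' : EspE L hL) :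
    secondVariationEFun L a q (p + p') =ᵐ[volume] fun ξ => secondVariationEFun L a q p ξ + secondVariationEFun L a q p' ξ := by
  obtain ⟨hae, hprof⟩ := derE_add hL p p'
  filter_upwards [hae] with ξ hξ
  obtain ⟨hH, hU⟩ := hilbertE_add hL p p' ξ
  have hpξ : profile (p + p') ξ = profile p ξ + profile p' ξ := by rw [hprof]
  simp only [secondVariationEFun]
  rw [hH, hU, hξ, hpξ]
  ring

include hL in
/-- `B⁺_u` is homogeneous in the even slot, almost everywhere. [folklore] -/
theorem secondVariationEFun_smul_right (q : Esp L hL) (c : ℝ) (p : EspE L hL) :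
    secondVariationEFun L a q (c • p) =ᵐ[volume] fun ξ => c * secondVariationEFun L a q p ξ := by
  obtain ⟨hae, hprof⟩ := derE_smul hL c p
  filter_upwards [hae] with ξ hξ
  obtain ⟨hH, hU⟩ := hilbertE_smul hL c p ξ
  have hpξ : profile (c • p) ξ = c * profile p ξ := by rw [hprof]
  simp only [secondVariationEFun]
  rw [hH, hU, hξ, hpξ]
  ring

/-- **The second variation in the direction of an odd `u ∈ Esp` as a bounded operator on the even class**,
`secondVariationE hL a u : EspE L hL →L[ℝ] W L`, `p ↦ B⁺_u δ` (as an `L²_w` class), with `‖B⁺_u δ‖ ≤ 2M_w‖u‖‖p‖`. [folklore] -/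
def secondVariationE (q : Esp L hL) : EspE L hL →L[ℝ] W L :=
  LinearMap.mkContinuous
    { toFun := fun p => (memLp_secondVariationEFun hL a q p).1.toLp (secondVariationEFun L a q p)
      map_add' := fun p p' => by
        rw [← MemLp.toLp_add]
        exact MemLp.toLp_congr _ _ (ae_μw_of_ae_volume (secondVariationEFun_add_right hL a q p p'))
      map_smul' := fun c p => by
        rw [RingHom.id_apply, ← MemLp.toLp_const_smul]
        exact MemLp.toLp_congr _ _ (ae_μw_of_ae_volume (secondVariationEFun_smul_right hL a q c p)) }
    (2 * Mw L a * ‖q‖)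
    fun p => by
      simp only [LinearMap.coe_mk, AddHom.coe_mk]
      rw [(norm_toLp_W hL (memLp_secondVariationEFun hL a q p).1).2]
      exact (memLp_secondVariationEFun hL a q p).2

/-- `secondVariationE u p` is the `L²_w` class of `B⁺_u δ`: a.e. equality and the bound `‖B⁺_u δ‖ ≤ 2M_w‖u‖‖p‖`. [folklore] -/
theorem secondVariationE_apply (q : Esp L hL) (p : EspE L hL) :
    ((((secondVariationE hL a q p : W L)) : ℝ → ℝ) =ᵐ[volume] secondVariationEFun L a q p) ∧
      ‖secondVariationE hL a q p‖ ≤ 2 * Mw L a * ‖q‖ * ‖p‖ := by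
  have h := norm_toLp_W hL (memLp_secondVariationEFun hL a q p).1
  have e : (secondVariationE hL a q p : W L) = (memLp_secondVariationEFun hL a q p).1.toLp (secondVariationEFun L a q p) := by
    simp only [secondVariationE, LinearMap.mkContinuous_apply, LinearMap.coe_mk, AddHom.coe_mk]
  rw [e]
  exact ⟨h.1, by rw [h.2]; exact (memLp_secondVariationEFun hL a q p).2⟩

/-- **`‖B⁺_u‖_{E⁺₀→L²_w} ≤ 2M_w‖u‖_E`.** [folklore] -/
theorem norm_secondVariationE_le (q : Esp L hL) : ‖secondVariationE hL a q‖ ≤ 2 * Mw L a * ‖q‖ := by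
  refine ContinuousLinearMap.opNorm_le_bound _ (by have := Mw_nonneg hL a; positivity) fun p => ?_
  exact (secondVariationE_apply hL a q p).2

end SecondVariation

/-! ### §2 At the frame of record `(L, a) = (8, 1/5)`: `‖B⁺_u‖ ≤ (L_lip/2)‖u‖_E ≤ Δ⁺/2` on the certified ball -/

section Record

open CertificateViscousSheetRSpectrumEven (DeltaE LlipE)
open CertificateViscousSheetR (Llip rEsharp2)

/-- **`‖B⁺_u‖ ≤ (L_lip/2)‖u‖_E` at `(L, a) = (8, 1/5)`** (`4M_w ≤ Llip`, selfsim's `four_Mw_le_Llip`): the even second variation obeys the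
same operator-norm bound as the odd one (`SheetRLinearisationPerturbation.norm_secondVariation_le_sheet`), as cert-1's
`evenLipschitzConstant_le_LlipE` anticipated at function level. [folklore] -/
theorem norm_secondVariationE_le_sheet (h8 : (0 : ℝ) < 8) (u : Esp 8 h8) :
    ‖secondVariationE h8 (1 / 5) u‖ ≤ (Llip : ℝ) / 2 * ‖u‖ := by
  have h1 := norm_secondVariationE_le h8 (1 / 5) u
  have h2 := four_Mw_le_Llip
  nlinarith [norm_nonneg u]

/-- **On the certified ball `‖u‖_E ≤ rE♯₂`: `‖B⁺_u‖ ≤ Δ⁺/2`** (`Δ⁺ = DeltaE = LlipE·rE♯₂`) — the hypothesis `‖K' − K‖ ≤ Δ⁺/2` of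
`SheetREvenLinearisationPerturbation.evansEven_pert_of_record` / `gardingDataKE_of_record` for `K' = K + B⁺_u`. MODEL statement; not NS. [folklore] -/
theorem norm_secondVariationE_le_DeltaE (h8 : (0 : ℝ) < 8) (u : Esp 8 h8) (hu : ‖u‖ ≤ (rEsharp2 : ℝ)) :
    ‖secondVariationE h8 (1 / 5) u‖ ≤ ((DeltaE : ℚ) : ℝ) / 2 := by
  have h1 := norm_secondVariationE_le_sheet h8 u
  have hD : ((DeltaE : ℚ) : ℝ) = (LlipE : ℝ) * rEsharp2 := by norm_num [DeltaE]
  have hL0 : (0 : ℝ) ≤ (Llip : ℝ) := by norm_num [Llip]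
  have hLE : (Llip : ℝ) ≤ (LlipE : ℝ) := by norm_num [Llip, LlipE]
  have hr0 : (0 : ℝ) ≤ (rEsharp2 : ℝ) := by norm_num [rEsharp2]
  rw [hD]
  calc ‖secondVariationE h8 (1 / 5) u‖ ≤ (Llip : ℝ) / 2 * ‖u‖ := h1
    _ ≤ (Llip : ℝ) / 2 * rEsharp2 := mul_le_mul_of_nonneg_left hu (by positivity)
    _ ≤ (LlipE : ℝ) / 2 * rEsharp2 := mul_le_mul_of_nonneg_right (by linarith) hr0
    _ = (LlipE : ℝ) * rEsharp2 / 2 := by ring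

/-- The same for `K' := K + B⁺_u` written as a difference: `‖(K + B⁺_u) − K‖ ≤ Δ⁺/2`. [folklore] -/
theorem norm_add_secondVariationE_sub_le (h8 : (0 : ℝ) < 8) (K : EspE 8 h8 →L[ℝ] W 8) (u : Esp 8 h8) (hu : ‖u‖ ≤ (rEsharp2 : ℝ)) :
    ‖(K + secondVariationE h8 (1 / 5) u) - K‖ ≤ ((DeltaE : ℚ) : ℝ) / 2 := by
  rw [add_sub_cancel_left]; exact norm_secondVariationE_le_DeltaE h8 u hu

end Record

end SheetREvenSecondVariation
end Summit.NavierStokesRegularity.OSWSelfSimilar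

end
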